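import Mathlib
import Literature.LinearAlgebra.Matrix.PermanentLaplace
import Summits.ValiantsHypothesis.ValiantsHypothesis.Theorems.ValuativeGCTValuativeFlipPencilBorderTools

/-!
# The border family in MATRIX FORM: row- and column-replaced permanents of the pencil and of its bordering
# (crux `ValuativeGCT.ValuativeFlip`, stmt-ValiantsHypothesis-12624; wall-breaker axis k8 gen 1, seat 2)

Helper file (`--supports stmt-ValiantsHypothesis-12624`), line `four-row-count`.  For ANY commutative
coefficient ring `K` and coefficient function `c : ℕ → ℕ → Fin 3 → K` (pattern `b i j (castSucc s)`, or the
universal `X (i,j,s)`, or a specialisation of it), the `8N+3` border forms of hypothesis `hr` of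
`fourRowPencilRank_of_borderRanks2` (written with `aeval`/`pderiv`/`perPoly`) are, member by member,
(a) `y_s · per P`, (b) `y_s · per(P; row k ← v)`, (c) `y_s · per(P; col l ← u)`, (d) `per(P⁺; row k ← row N)`,
(e) `per(P⁺; col l ← col N)`, where `P` is the `N × N` pencil matrix, `P⁺` the `(N+1) × (N+1)` one (whose last
row / column is the border `v` / `u` and whose corner vanishes) — `mf_borderFamily_eq`.  This is the form in
which the block identities `bb_*` (`…BlockBorder`) apply. [this crux, line four-row-count; folklore]
-/

set_option linter.dupNamespace false
set_option maxHeartbeats 800000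

namespace Summit.ValiantsHypothesis.ValiantsHypothesis.Theorems.ValuativeFlip

open scoped BigOperators
open MvPolynomial Matrix Literature.Computability.AlgebraicComplexity

section MatrixForm

/-- Laplace along a replaced row: `Σ_l v_l · per A(k|l) = per(A; row k ← v)`. [folklore] -/
theorem mf_sum_mul_permanent_submatrix_row {K : Type*} [CommRing K] {n : ℕ} (A : Matrix (Fin (n + 1)) (Fin (n + 1)) K) (k : Fin (n + 1))
    (v : Fin (n + 1) → K) :
    ∑ l : Fin (n + 1), v l * (A.submatrix k.succAbove l.succAbove).permanent = (A.updateRow k v).permanent := by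
  rw [permanent_eq_sum_row (A.updateRow k v) k]
  refine Finset.sum_congr rfl fun l _ => ?_
  rw [updateRow_self, submatrix_updateRow_succAbove]

/-- Laplace along a replaced column: `Σ_k u_k · per A(k|l) = per(A; col l ← u)`. [folklore] -/
theorem mf_sum_mul_permanent_submatrix_col {K : Type*} [CommRing K] {n : ℕ} (A : Matrix (Fin (n + 1)) (Fin (n + 1)) K) (l : Fin (n + 1))
    (u : Fin (n + 1) → K) :
    ∑ k : Fin (n + 1), u k * (A.submatrix k.succAbove l.succAbove).permanent = (A.updateCol l u).permanent := by
  rw [← permanent_transpose, ← updateRow_transpose, ← mf_sum_mul_permanent_submatrix_row]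
  refine Finset.sum_congr rfl fun k _ => ?_
  rw [← permanent_transpose, transpose_submatrix]

/-- Laplace along a replaced row of a bordered matrix whose replacing row has last entry `0`: only the first
`n + 1` columns contribute. [folklore] -/
theorem mf_permanent_updateRow_border {K : Type*} [CommRing K] {n : ℕ} (A : Matrix (Fin (n + 2)) (Fin (n + 2)) K) (i : Fin (n + 2))
    (w : Fin (n + 2) → K) (hw : w (Fin.last (n + 1)) = 0) :
    (A.updateRow i w).permanent =
      ∑ l : Fin (n + 1), w (Fin.castSucc l) * (A.submatrix i.succAbove (Fin.castSucc l).succAbove).permanent := by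
  rw [← mf_sum_mul_permanent_submatrix_row, Fin.sum_univ_castSucc, hw, zero_mul, add_zero]

/-- Column version of `mf_permanent_updateRow_border`. [folklore] -/
theorem mf_permanent_updateCol_border {K : Type*} [CommRing K] {n : ℕ} (A : Matrix (Fin (n + 2)) (Fin (n + 2)) K) (j : Fin (n + 2))
    (w : Fin (n + 2) → K) (hw : w (Fin.last (n + 1)) = 0) :
    (A.updateCol j w).permanent =
      ∑ k : Fin (n + 1), w (Fin.castSucc k) * (A.submatrix (Fin.castSucc k).succAbove j.succAbove).permanent := by
  rw [← mf_sum_mul_permanent_submatrix_col, Fin.sum_univ_castSucc, hw, zero_mul, add_zero]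

/-- Laplace along a column replaced by the LAST column of a bordered matrix with vanishing corner. [folklore] -/
theorem mf_permanent_updateCol_lastCol {K : Type*} [CommRing K] {n : ℕ} (A : Matrix (Fin (n + 2)) (Fin (n + 2)) K) (j : Fin (n + 2))
    (hA : A (Fin.last (n + 1)) (Fin.last (n + 1)) = 0) :
    (A.updateCol j (fun i => A i (Fin.last (n + 1)))).permanent =
      ∑ k : Fin (n + 1), A (Fin.castSucc k) (Fin.last (n + 1)) * (A.submatrix (Fin.castSucc k).succAbove j.succAbove).permanent :=
  mf_permanent_updateCol_border A j (fun i => A i (Fin.last (n + 1))) hA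

/-- Laplace along a row replaced by the LAST row of a bordered matrix with vanishing corner. [folklore] -/
theorem mf_permanent_updateRow_lastRow {K : Type*} [CommRing K] {n : ℕ} (A : Matrix (Fin (n + 2)) (Fin (n + 2)) K) (i : Fin (n + 2)) (hA : A (Fin.last (n + 1)) (Fin.last (n + 1)) = 0) : (A.updateRow i (A (Fin.last (n + 1)))).permanent = ∑ l : Fin (n + 1), A (Fin.last (n + 1)) (Fin.castSucc l) * (A.submatrix i.succAbove (Fin.castSucc l).succAbove).permanent :=
  mf_permanent_updateRow_border A i (A (Fin.last (n + 1))) hA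

/-- **The border family in matrix form.**  Member by member, the `aeval`-form family of hypothesis `hr`
(coefficient function `c`, base `n₁`, step `k`, `N = n₁+k+1`) equals: `y_s · per P`, `y_s · per(P; row k ← v)`,
`y_s · per(P; col l ← u)`, `per(P⁺; row castSucc k ← row last)`, `per(P⁺; col castSucc l ← col last)`.
[this crux, line four-row-count; folklore] -/
theorem mf_borderFamily_eq {K : Type*} [CommRing K] (c : ℕ → ℕ → Fin 3 → K) (n₁ k : ℕ) :
    ((Sum.elim (fun s : Fin 3 => (X s : MvPolynomial (Fin 3) K) * aeval (fun ij : Fin (n₁ + k + 1) × Fin (n₁ + k + 1) => ∑ s : Fin 3, (if ((ij.1 : ℕ) = (ij.2 : ℕ) ∧ n₁ + 1 ≤ (ij.1 : ℕ)) then (0 : K) else c (ij.1 : ℕ) (ij.2 : ℕ) s) • (X s : MvPolynomial (Fin 3) K)) (perPoly (Fin (n₁ + k + 1)) K)) (Sum.elim (fun sk : Fin 3 × Fin (n₁ + k + 1) => (X sk.1 : MvPolynomial (Fin 3) K) * ∑ l : Fin (n₁ + k + 1), (∑ s : Fin 3, c (n₁ + k + 1) ((l : Fin (n₁ + k + 1))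 : ℕ) s • (X s : MvPolynomial (Fin 3) K)) * aeval (fun ij : Fin (n₁ + k + 1) × Fin (n₁ + k + 1) => ∑ s : Fin 3, (if ((ij.1 : ℕ) = (ij.2 : ℕ) ∧ n₁ + 1 ≤ (ij.1 : ℕ)) then (0 : K) else c (ij.1 : ℕ) (ij.2 : ℕ) s) • (X s : MvPolynomial (Fin 3) K)) (pderiv (sk.2, l) (perPoly (Fin (n₁ + k + 1)) K))) (Sum.elim (fun sl : Fin 3 × Fin (n₁ + k + 1) => (X sl.1 : MvPolynomial (Fin 3) K) * ∑ k' : Fin (n₁ + k + 1), (∑ s : Fin 3, c ((k' : Fin (n₁ + k + 1)) : ℕ) (n₁ + k + 1) s • (X s : MvPolynomial (Fin 3) K)) * aeval (fun ij : Fin (n₁ + k + 1) × Fin (n₁ + k + 1) => ∑ s : Fin 3, (if ((ij.1 : ℕ) = (ij.2 : ℕ) ∧ n₁ + 1 ≤ (ij.1 : ℕ)) then (0 : K) else c (ij.1 : ℕ) (ij.2 : ℕ) s) • (X s : MvPolynomial (Fin 3) K)) (pderiv (k', sl.2) (perPoly (Fin (n₁ + k + 1)) K))) (Sum.elim (fun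 k' : Fin (n₁ + k + 1) => ∑ l : Fin (n₁ + k + 1), (∑ s : Fin 3, c (n₁ + k + 1) ((l : Fin (n₁ + k + 1)) : ℕ) s • (X s : MvPolynomial (Fin 3) K)) * aeval (fun ij : Fin (n₁ + k + 2) × Fin (n₁ + k + 2) => ∑ s : Fin 3, (if ((ij.1 : ℕ) = (ij.2 : ℕ) ∧ n₁ + 1 ≤ (ij.1 : ℕ)) then (0 : K) else c (ij.1 : ℕ) (ij.2 : ℕ) s) • (X s : MvPolynomial (Fin 3) K)) (pderiv (Fin.castSucc k', Fin.castSucc l) (perPoly (Fin (n₁ + k + 2)) K))) (fun l : Fin (n₁ + k + 1) => ∑ k' : Fin (n₁ + k + 1), (∑ s : Fin 3, c ((k' : Fin (n₁ + k + 1)) : ℕ) (n₁ + k + 1) s • (X s : MvPolynomial (Fin 3) K)) * aeval (fun ij : Fin (n₁ + k + 2) × Fin (n₁ + k + 2) => ∑ s : Fin 3, (if ((ij.1 : ℕ) = (ij.2 : ℕ) ∧ n₁ + 1 ≤ (ij.1 : ℕ)) then (0 : K) else c (ij.1 : ℕ) (ij.2 : ℕ) s) • (X s : MvPolynomial (Fin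 3) K)) (pderiv (Fin.castSucc k', Fin.castSucc l) (perPoly (Fin (n₁ + k + 2)) K))))))) : (Fin 3 ⊕ ((Fin 3 × Fin (n₁ + k + 1)) ⊕ ((Fin 3 × Fin (n₁ + k + 1)) ⊕ (Fin (n₁ + k + 1) ⊕ Fin (n₁ + k + 1))))) → MvPolynomial (Fin 3) K) =
    (Sum.elim (fun s : Fin 3 => (X s : MvPolynomial (Fin 3) K) * ((Matrix.of fun i j : Fin (n₁ + k + 1) => (fun ij : Fin (n₁ + k + 1) × Fin (n₁ + k + 1) => ∑ s : Fin 3, (if ((ij.1 : ℕ) = (ij.2 : ℕ) ∧ n₁ + 1 ≤ (ij.1 : ℕ)) then (0 : K) else c (ij.1 : ℕ) (ij.2 : ℕ) s) • (X s : MvPolynomial (Fin 3) K)) (i, j))).permanent) (Sum.elim (fun sk : Fin 3 × Fin (n₁ + k + 1) => (X sk.1 : MvPolynomial (Fin 3) K) * (((Matrix.of fun i j : Fin (n₁ + k + 1) => (fun ij : Fin (n₁ + k + 1) × Fin (n₁ + k + 1) => ∑ s : Fin 3, (if ((ij.1 : ℕ) = (ij.2 : ℕ) ∧ n₁ + 1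 ≤ (ij.1 : ℕ)) then (0 : K) else c (ij.1 : ℕ) (ij.2 : ℕ) s) • (X s : MvPolynomial (Fin 3) K)) (i, j))).updateRow sk.2 (fun l : Fin (n₁ + k + 1) => ∑ s : Fin 3, c (n₁ + k + 1) ((l : Fin (n₁ + k + 1)) : ℕ) s • (X s : MvPolynomial (Fin 3) K))).permanent) (Sum.elim (fun sl : Fin 3 × Fin (n₁ + k + 1) => (X sl.1 : MvPolynomial (Fin 3) K) * (((Matrix.of fun i j : Fin (n₁ + k + 1) => (fun ij : Fin (n₁ + k + 1) × Fin (n₁ + k + 1) => ∑ s : Fin 3, (if ((ij.1 : ℕ) = (ij.2 : ℕ) ∧ n₁ + 1 ≤ (ij.1 : ℕ)) then (0 : K) else c (ij.1 : ℕ) (ij.2 : ℕ) s) • (X s : MvPolynomial (Fin 3) K)) (i, j))).updateCol sl.2 (fun i : Fin (n₁ + k + 1) => ∑ s : Fin 3, c ((i : Fin (n₁ + k + 1)) : ℕ) (n₁ + k + 1) s • (X s : MvPolynomial (Fin 3) K))).permanent) (Sum.elim (fun k' : Fin (n₁ + k + 1) => (((Matrix.of fun i j : Fin (n₁ + k + 2)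 => (fun ij : Fin (n₁ + k + 2) × Fin (n₁ + k + 2) => ∑ s : Fin 3, (if ((ij.1 : ℕ) = (ij.2 : ℕ) ∧ n₁ + 1 ≤ (ij.1 : ℕ)) then (0 : K) else c (ij.1 : ℕ) (ij.2 : ℕ) s) • (X s : MvPolynomial (Fin 3) K)) (i, j))).updateRow (Fin.castSucc k') (((Matrix.of fun i j : Fin (n₁ + k + 2) => (fun ij : Fin (n₁ + k + 2) × Fin (n₁ + k + 2) => ∑ s : Fin 3, (if ((ij.1 : ℕ) = (ij.2 : ℕ) ∧ n₁ + 1 ≤ (ij.1 : ℕ)) then (0 : K) else c (ij.1 : ℕ) (ij.2 : ℕ) s) • (X s : MvPolynomial (Fin 3) K)) (i, j))) (Fin.last (n₁ + k + 1)))).permanent) (fun l : Fin (n₁ + k + 1) => (((Matrix.of fun i j : Fin (n₁ + k + 2) => (fun ij : Fin (n₁ + k + 2) × Fin (n₁ + k + 2) => ∑ s : Fin 3, (if ((ij.1 : ℕ) = (ij.2 : ℕ) ∧ n₁ + 1 ≤ (ij.1 : ℕ)) then (0 : K) else c (ij.1 : ℕ) (ij.2 : ℕ) s) • (X s : MvPolynomial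 (Fin 3) K)) (i, j))).updateCol (Fin.castSucc l) (fun i => ((Matrix.of fun i j : Fin (n₁ + k + 2) => (fun ij : Fin (n₁ + k + 2) × Fin (n₁ + k + 2) => ∑ s : Fin 3, (if ((ij.1 : ℕ) = (ij.2 : ℕ) ∧ n₁ + 1 ≤ (ij.1 : ℕ)) then (0 : K) else c (ij.1 : ℕ) (ij.2 : ℕ) s) • (X s : MvPolynomial (Fin 3) K)) (i, j))) i (Fin.last (n₁ + k + 1)))).permanent))))) := by
  have hlast0 : (Matrix.of fun i j : Fin (n₁ + k + 2) => (fun ij : Fin (n₁ + k + 2) × Fin (n₁ + k + 2) => ∑ s : Fin 3, (if ((ij.1 : ℕ) = (ij.2 : ℕ) ∧ n₁ + 1 ≤ (ij.1 : ℕ)) then (0 : K) else c (ij.1 : ℕ) (ij.2 : ℕ) s) • (X s : MvPolynomial (Fin 3) K)) (i, j)) (Fin.last (n₁ + k + 1)) (Fin.last (n₁ + k + 1)) = 0 := by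
    simp
  have hlastrow : ∀ l : Fin (n₁ + k + 1), (Matrix.of fun i j : Fin (n₁ + k + 2) => (fun ij : Fin (n₁ + k + 2) × Fin (n₁ + k + 2) => ∑ s : Fin 3, (if ((ij.1 : ℕ) = (ij.2 : ℕ) ∧ n₁ + 1 ≤ (ij.1 : ℕ)) then (0 : K) else c (ij.1 : ℕ) (ij.2 : ℕ) s) • (X s : MvPolynomial (Fin 3) K)) (i, j)) (Fin.last (n₁ + k + 1)) (Fin.castSucc l) = (fun l : Fin (n₁ + k + 1) => ∑ s : Fin 3, c (n₁ + k + 1) ((l : Fin (n₁ + k + 1)) : ℕ) s • (X s : MvPolynomial (Fin 3) K)) l := by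
    intro l
    have hl : (n₁ + k + 1 : ℕ) ≠ (l : ℕ) := ne_of_gt l.isLt
    simp [hl]
  have hlastcol : ∀ i : Fin (n₁ + k + 1), (Matrix.of fun i j : Fin (n₁ + k + 2) => (fun ij : Fin (n₁ + k + 2) × Fin (n₁ + k + 2) => ∑ s : Fin 3, (if ((ij.1 : ℕ) = (ij.2 : ℕ) ∧ n₁ + 1 ≤ (ij.1 : ℕ)) then (0 : K) else c (ij.1 : ℕ) (ij.2 : ℕ) s) • (X s : MvPolynomial (Fin 3) K)) (i, j)) (Fin.castSucc i) (Fin.last (n₁ + k + 1)) = (fun i : Fin (n₁ + k + 1) => ∑ s : Fin 3, c ((i : Fin (n₁ + k + 1)) : ℕ) (n₁ + k + 1) s • (X s : MvPolynomial (Fin 3) K)) i := by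
    intro i
    have hi : (i : ℕ) ≠ (n₁ + k + 1 : ℕ) := ne_of_lt i.isLt
    simp [hi]
  refine funext fun idx => ?_
  rcases idx with s | sk | sl | k' | l
  · simp only [Sum.elim_inl, pb_aeval_perPoly]
  · simp only [Sum.elim_inl, Sum.elim_inr, pb_aeval_pderiv_perPoly, mf_sum_mul_permanent_submatrix_row]
  · simp only [Sum.elim_inl, Sum.elim_inr, pb_aeval_pderiv_perPoly, mf_sum_mul_permanent_submatrix_col]
  · simp only [Sum.elim_inl, Sum.elim_inr, pb_aeval_pderiv_perPoly, mf_permanent_updateRow_lastRow _ _ hlast0, hlastrow]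
  · simp only [Sum.elim_inr, pb_aeval_pderiv_perPoly, mf_permanent_updateCol_lastCol _ _ hlast0, hlastcol]

end MatrixForm

end Summit.ValiantsHypothesis.ValiantsHypothesis.Theorems.ValuativeFlip
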